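import Summits.PneNP.PneNP.Theorems.ChebyshevTracialDesignPairContainmentEntrywise
import Summits.PneNP.PneNP.Theorems.ChebyshevTracialDesignLowDegreeMasks
import Summits.PneNP.PneNP.Theorems.ChebyshevTracialDesignTightColumnSums
import Summits.PneNP.PneNP.Theorems.ChebyshevTracialDesignUnconditionalRungsB
import Literature.Computability.Complexity.KnapsackSosDegree
import HarnessLib

/-!
# Cell pnp-psdrank, route `ChebyshevTracialDesign`: two PRICED CELLS of the pair-containment statement (CG_1') —
# (i) SOS / Boolean masks of Johnson degree `j ≤ D − 2` are EXACT per matching (`Σ_U W(U,M) f(U) C_v(U)² ≤ 0` for every `M`, every `v`), and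
# (ii) the LEVEL direction `v = 𝟙` is priced for EVERY mask by the `r = 1` rung of the polynomially MODIFIED design `w_c·(1 − c/t)²`
# (crux `TracialDecayExp20`, stmt-PneNP-19878)

Brick 103 (prover g19; MEMO-22 §1–§2). The pair-containment form of a mask `f : cuts → [0,1]` at a matching `M` in direction `v` is
`Q^f_M(v) := Σ_U W(U,M) f(U)·C_v(U)²`, `C_v(U) = Σ_p v_p x_p x_{π_M p}` (`x_p = 1[p ∈ U]`, `π_M` the partner map); (CG_1') asks
`Σ_M sup_{|v|≤1} Q^f_M(v)₊ ≤ e^{−aD}` (bricks 98–102). This file prices two cells.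
* §1 **Polynomially modified designs.** `levelWeight_mul` (`levelWeight (w·g) = g(cc)·levelWeight w`) and **`isExactDesign_mul_poly`**: for a
  real polynomial `p` with `deg p ≤ j < D`, `p(0) = 1` and `|p(c)| ≤ L` on the design levels, `(C, w·p)` is an exact design of degree `D − j`
  and variation `≤ B·L` — NORMALISATION INCLUDED (`Σ_c w_c p(c)(c−1) = −p(0)(0−1) = 1` by exactness on `(X−1)p`). Brick 43
  (`…SquareSlackDesign`, `p = (X−1)²`) is the instance that motivated it; here the instance is `p = (1 − X/t)²` (`isExactDesign_levelSq`).
* §2 **The level direction.** On a `t`-cut, `Σ_p x_p x_{π_M p} = t − cc(U,M)` (`sum_containment_eq`, via `cc = #{p ∈ U : π p ∉ U}` of brick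
  `…TightColumnSums`), so `Q^f_M(a·𝟙) = a²·Σ_U W̃(U,M) f(U)·t²` with `w̃_c = w_c (1 − c/t)²`; hence for ANY weight whose modified weight has
  all-rectangle bound `γ'`: **`sum_posPart_containment_ones_le`** `Σ_M (Q^f_M(a_M 𝟙))₊ ≤ t²·γ'` (`|a_M| ≤ 1`, M-dependent), and unconditionally
  for balanced Chebyshev designs **`containment_ones_decay`** (`γ' = 20·e^{−a·dq n}` by `rectangleDecayAll_holds` at degree `dq n − 2`).
  Reading: the COMMON-MODE direction of (CG_1') (all edges of `M` weighted alike) is the `r = 1` rung of a degree-`(D−2)` design; with brick 102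
  (sign-coherent cone) the open part of (CG_1') is confined to sign patterns that are neither coherent nor constant.
* §3 **Low-degree SOS / Boolean masks are exact, per matching.** `containment_mem_lowSpan` (`C_v ∈ V_2`), **`containment_sosMask_nonpos`**: for
  an exact design of degree `D`, scalars `g_1,…,g_L` of Johnson degree `≤ j` with `j + 2 ≤ D` and `2(j+2) ≤ t + 1`, EVERY `M` and EVERY `v`:
  `Σ_U W(U,M)·(Σ_l g_l(U)²)·C_v(U)² ≤ 0` (the Literature half-degree law `sum_levelWeight_trace_nonpos_of_lowDegree_sharp` with the matching
  side `δ_M`); **`containment_boolMask_nonpos`** ({0,1}-valued masks of degree `≤ j`, e.g. juntas `1[J ⊆ U]`), `containment_one_nonpos`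
  (`f ≡ 1`, the face computed in closed form by brick 98). So (CG_1') is SIGN-exact — zero defect, no averaging over `M`, no bound on `v` — on
  the whole cell of masks that are sums of squares of degree `≤ D − 2`.
[cite: Grigoriev2001, Lemma 1.4 (PDF p. 8)] [cite: Rothvoss2017, §2 and Lemma 7 (PDF pp. 6–8)] [cite: KeevashLifshitz2023, Thm. 1.8]
[cite: CoppersmithRivlin1992, Thm. (p. 970)] [cite: GriblingDelaatLaurent2019, §5]
Stature: support/instrument (kernel lane, no defs, axioms standard). WHAT THIS IS NOT: nothing on masks of high approximate degree in
sign-incoherent non-constant directions (that is the open part of (CG_1')), no proof or refutation of `TracialDecayExp20`, nothing on psd rank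
of P_PM(K_n), no P-vs-NP content. Supports stmt-PneNP-19878.
-/

set_option linter.dupNamespace false -- `Summit.PneNP.PneNP.…`: summit = sub-problem (D-0017)

noncomputable section

namespace Summit.PneNP.PneNP.Theorems.ChebyshevTracialDesignPairContainmentCells

open Finset Matrix Polynomial Literature.Barriers.PneNP Literature.Combinatorics.Optimization
open Literature.Computability.Complexity (Grigoriev2001_knapsackFormNonneg_holds)
open Literature.Combinatorics.Optimization.ChebyshevTracialDesignJunta (sum_levelWeight_trace_nonpos_of_lowDegree_sharp)
open Summit.PneNP.PneNP.Theorems.ChebyshevTracialDesignPairContainmentEntrywise (sum_posPart_mul_le_of_rectangles)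
open Summit.PneNP.PneNP.Theorems.ChebyshevTracialDesignLowDegreeMasks (mul_mem_lowSpan)
open Summit.PneNP.PneNP.Theorems.ChebyshevTracialDesignTightColumnSums (cc_eq_card_filter_partner)
open Summit.PneNP.PneNP.Theorems.ChebyshevTracialDesignUnconditionalRungs (rectangleDecayAll_holds)

variable {n : ℕ}

/-! ### §1 Polynomially modified designs -/

/-- **Reweighting the levels multiplies the weight**: `levelWeight (c ↦ w_c·g(c)) (U,M) = g(cc(U,M))·levelWeight w (U,M)`.
[cite: Rothvoss2017, §2 (PDF p. 6)] -/
theorem levelWeight_mul (t : ℕ) (C : Finset ℕ) (w : ℕ → ℝ) (g : ℕ → ℝ) (U : OddSet n) (M : PMatch n) :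
    levelWeight n t C (fun c => w c * g c) U M = g (cc U M) * levelWeight n t C w U M := by
  classical
  unfold levelWeight
  rw [mul_sum]
  refine sum_congr rfl fun c _ => ?_
  by_cases h : (U, M) ∈ Qset n t c
  · rw [if_pos h, if_pos h, (mem_Qset_iff.1 h).2]; ring
  · rw [if_neg h, if_neg h, mul_zero]

/-- **A polynomially modified exact design is an exact design.** If `(C, w)` is an exact design of degree `D` on the `t`-cuts and `p` is a
real polynomial with `deg p ≤ j`, `j < D`, `p(0) = 1` and `|p(c)| ≤ L` on the design levels, then `(C, c ↦ w_c·p(c))` is an exact design of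
degree `D − j` with variation `≤ B·L` (normalisation from exactness on `(X − 1)·p`, exactness on `p·q`).
[cite: CoppersmithRivlin1992, Thm. (p. 970)] [cite: Rothvoss2017, §2 (PDF p. 6)] -/
theorem isExactDesign_mul_poly {t T D : ℕ} {B : ℝ} {C : Finset ℕ} {w : ℕ → ℝ} (h : IsExactDesign n t T D B C w)
    (p : Polynomial ℝ) {j : ℕ} (hpj : p.natDegree ≤ j) (hjD : j < D) (hp0 : p.eval 0 = 1) {L : ℝ} (hpL : ∀ c ∈ C, |p.eval (c : ℝ)| ≤ L) :
    IsExactDesign n t T (D - j) (B * L) C (fun c => w c * p.eval (c : ℝ)) := by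
  obtain ⟨hodd, h2t, hTt, hC, hnorm, hexact, hvar⟩ := h
  refine ⟨hodd, h2t, hTt, hC, ?_, fun q hq => ?_, ?_⟩
  · -- normalisation: apply the design to `(X − 1)·p`
    have h1 := hexact ((X - Polynomial.C (1 : ℝ)) * p) (by
      calc ((X - Polynomial.C (1 : ℝ)) * p).natDegree ≤ (X - Polynomial.C (1 : ℝ)).natDegree + p.natDegree := natDegree_mul_le
        _ ≤ 1 + j := by rw [natDegree_X_sub_C]; omega
        _ ≤ D := by omega)
    simp only [eval_mul, eval_sub, eval_X, eval_C, hp0] at h1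
    calc ∑ c ∈ C, w c * p.eval (c : ℝ) * ((c : ℝ) - 1) = ∑ c ∈ C, w c * (((c : ℝ) - 1) * p.eval (c : ℝ)) :=
          sum_congr rfl fun c _ => by ring
      _ = 1 := by rw [h1]; norm_num
  · -- exactness in degree `≤ D − j`
    have h1 := hexact (p * q) (by
      calc (p * q).natDegree ≤ p.natDegree + q.natDegree := natDegree_mul_le
        _ ≤ j + (D - j) := by omega
        _ = D := by omega)
    simp only [eval_mul, hp0, one_mul] at h1
    calc ∑ c ∈ C, w c * p.eval (c : ℝ) * q.eval (c : ℝ) = ∑ c ∈ C, w c * (p.eval (c : ℝ) * q.eval (c : ℝ)) :=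
          sum_congr rfl fun c _ => by ring
      _ = -q.eval 0 := h1
  · -- variation
    calc ∑ c ∈ C, |w c * p.eval (c : ℝ)| ≤ ∑ c ∈ C, |w c| * L := sum_le_sum fun c hc => by
          rw [abs_mul]; exact mul_le_mul_of_nonneg_left (hpL c hc) (abs_nonneg _)
      _ = (∑ c ∈ C, |w c|) * L := by rw [sum_mul]
      _ ≤ B * L := by
          have hL : 0 ≤ L := by
            by_cases hCe : C = ∅
            · -- no levels: normalisation `Σ_∅ = 1` is impossible
              rw [hCe, sum_empty] at hnorm; exact absurd hnorm (by norm_num)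
            · obtain ⟨c, hc⟩ := Finset.nonempty_iff_ne_empty.2 hCe
              exact (abs_nonneg _).trans (hpL c hc)
          exact mul_le_mul_of_nonneg_right hvar hL

/-- **The squared-level modification `w_c·(1 − c/t)²` is an exact design of degree `D − 2` with the SAME variation bound** (`3 ≤ D`):
`p = (1 − X/t)²` has `p(0) = 1` and `0 ≤ p(c) ≤ 1` on `0 ≤ c ≤ t`. [cite: CoppersmithRivlin1992, Thm. (p. 970)] [cite: Rothvoss2017, §2 (PDF p. 6)] -/
theorem isExactDesign_levelSq {t T D : ℕ} {B : ℝ} {C : Finset ℕ} {w : ℕ → ℝ} (h : IsExactDesign n t T D B C w) (hD : 3 ≤ D) :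
    IsExactDesign n t T (D - 2) B C (fun c => w c * (1 - (c : ℝ) / t) ^ 2) := by
  have ht0 : 0 < t := h.1.pos
  have htR : (0 : ℝ) < t := by exact_mod_cast ht0
  set p : Polynomial ℝ := (Polynomial.C (1 : ℝ) - Polynomial.C ((t : ℝ)⁻¹) * X) ^ 2 with hp
  have hpeval : ∀ c : ℝ, p.eval c = (1 - c / t) ^ 2 := fun c => by
    rw [hp]; simp only [eval_pow, eval_sub, eval_C, eval_mul, eval_X]; rw [div_eq_inv_mul]
  have hpdeg : p.natDegree ≤ 2 := by
    rw [hp]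
    refine (natDegree_pow_le).trans ?_
    have : (Polynomial.C (1 : ℝ) - Polynomial.C ((t : ℝ)⁻¹) * X).natDegree ≤ 1 := by
      refine (natDegree_sub_le _ _).trans (max_le ?_ ?_)
      · rw [natDegree_C]; exact zero_le_one
      · exact (natDegree_C_mul_le _ _).trans (by rw [natDegree_X])
    omega
  have hmain := isExactDesign_mul_poly h p hpdeg (by omega : 2 < D) (by rw [hpeval]; simp) (L := 1) (fun c hc => by
    rw [hpeval, abs_of_nonneg (sq_nonneg _)]
    obtain ⟨-, -, hcT, -⟩ := h.2.2.2.1 c hc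
    have hct : (c : ℝ) ≤ t := by exact_mod_cast hcT.trans h.2.2.1
    have h0 : 0 ≤ 1 - (c : ℝ) / t := by rw [sub_nonneg, div_le_one htR]; exact hct
    have h1 : 1 - (c : ℝ) / t ≤ 1 := by
      have : 0 ≤ (c : ℝ) / t := div_nonneg (Nat.cast_nonneg _) htR.le
      linarith
    nlinarith)
  rw [mul_one] at hmain
  simp only [hpeval] at hmain
  exact hmain

/-! ### §2 The level direction `v = 𝟙` -/

/-- **On a cut, `Σ_p x_p x_{π_M p} = |U| − cc(U,M)`** (twice the number of edges of `M` inside `U`).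
[cite: Rothvoss2017, §2 (PDF p. 6)] -/
theorem sum_containment_eq (U : OddSet n) (M : PMatch n) :
    ∑ p : Fin n, (if p ∈ U.1 then (1 : ℝ) else 0) * (if M.2.partner p ∈ U.1 then (1 : ℝ) else 0) = (U.1.card : ℝ) - (cc U M : ℝ) := by
  classical
  rw [cc_eq_card_filter_partner U M]
  have h1 : ((U.1.filter fun x => M.2.partner x ∉ U.1).card : ℝ) =
      ∑ p : Fin n, (if p ∈ U.1 then (1 : ℝ) else 0) * (if M.2.partner p ∈ U.1 then (0 : ℝ) else 1) := by
    rw [Finset.card_filter, Nat.cast_sum, ← Finset.sum_subset (Finset.subset_univ U.1)]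
    · refine sum_congr rfl fun p hp => ?_
      rw [if_pos hp, one_mul]; split_ifs <;> simp
    · intro p _ hp; rw [if_neg hp, zero_mul]
  have h2 : (U.1.card : ℝ) = ∑ p : Fin n, (if p ∈ U.1 then (1 : ℝ) else 0) := by
    rw [Finset.card_eq_sum_ones, Nat.cast_sum, ← Finset.sum_subset (Finset.subset_univ U.1)]
    · exact sum_congr rfl fun p hp => by rw [if_pos hp]; simp
    · intro p _ hp; rw [if_neg hp]
  rw [h1, h2, ← sum_sub_distrib]
  refine sum_congr rfl fun p _ => ?_
  split_ifs <;> ring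

/-- **THE LEVEL DIRECTION OF (CG_1') IS AN `r = 1` RUNG OF THE MODIFIED DESIGN.** For a design `(t, C, w)` with `0 < t`, a mask
`f : cuts → [0,1]`, matching-dependent scalars `|a_M| ≤ 1`, and any `γ'` bounding the rectangle sums of the modified weight
`W̃ = levelWeight n t C (c ↦ w_c (1 − c/t)²)`:
`Σ_M (Σ_U W(U,M) f(U)·(Σ_p a_M x_p x_{π_M p})²)₊ ≤ t²·γ'`. [cite: Rothvoss2017, §2 and Lemma 7 (PDF pp. 6–8)] [cite: GriblingDelaatLaurent2019, §5] -/
theorem sum_posPart_containment_ones_le {t : ℕ} (ht : 0 < t) (C : Finset ℕ) (w : ℕ → ℝ) {γ' : ℝ}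
    (hR : ∀ (A : Finset (OddSet n)) (B : Finset (PMatch n)),
      ∑ U ∈ A, ∑ M ∈ B, levelWeight n t C (fun c => w c * (1 - (c : ℝ) / t) ^ 2) U M ≤ γ')
    (f : OddSet n → ℝ) (hf : ∀ U, 0 ≤ f U ∧ f U ≤ 1) (a : PMatch n → ℝ) (ha : ∀ M, |a M| ≤ 1) :
    ∑ M : PMatch n, max (∑ U : OddSet n, levelWeight n t C w U M *
        (f U * (∑ p, a M * ((if p ∈ U.1 then (1 : ℝ) else 0) * (if M.2.partner p ∈ U.1 then (1 : ℝ) else 0))) ^ 2)) 0 ≤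
      (t : ℝ) ^ 2 * γ' := by
  classical
  have htR : (0 : ℝ) < t := by exact_mod_cast ht
  -- on the support of the weight, `(Σ_p x_p x_{πp})² = (t − cc)² = t²(1 − cc/t)²`
  have hkey : ∀ (U : OddSet n) (M : PMatch n),
      levelWeight n t C w U M * (∑ p, (if p ∈ U.1 then (1 : ℝ) else 0) * (if M.2.partner p ∈ U.1 then (1 : ℝ) else 0)) ^ 2 =
        (t : ℝ) ^ 2 * levelWeight n t C (fun c => w c * (1 - (c : ℝ) / t) ^ 2) U M := by
    intro U M
    rw [levelWeight_mul, sum_containment_eq]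
    by_cases hU : U.1.card = t
    · rw [hU]; field_simp
    · -- off the `t`-cuts the weight vanishes
      have h0 : levelWeight n t C w U M = 0 := by
        unfold levelWeight
        exact sum_eq_zero fun c _ => by rw [if_neg]; exact fun h => hU (mem_Qset_iff.1 h).1
      rw [h0]; ring
  have hpt : ∀ (U : OddSet n) (M : PMatch n), levelWeight n t C w U M *
      (f U * (∑ p, a M * ((if p ∈ U.1 then (1 : ℝ) else 0) * (if M.2.partner p ∈ U.1 then (1 : ℝ) else 0))) ^ 2) =
      (t : ℝ) ^ 2 * (a M ^ 2 * (levelWeight n t C (fun c => w c * (1 - (c : ℝ) / t) ^ 2) U M * f U)) := by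
    intro U M
    rw [← mul_sum, mul_pow]
    linear_combination (f U * a M ^ 2) * hkey U M
  have hval : ∀ M : PMatch n, ∑ U : OddSet n, levelWeight n t C w U M *
      (f U * (∑ p, a M * ((if p ∈ U.1 then (1 : ℝ) else 0) * (if M.2.partner p ∈ U.1 then (1 : ℝ) else 0))) ^ 2) =
      (t : ℝ) ^ 2 * (a M ^ 2 * ∑ U : OddSet n, levelWeight n t C (fun c => w c * (1 - (c : ℝ) / t) ^ 2) U M * f U) := by
    intro M
    rw [mul_sum, mul_sum]
    exact sum_congr rfl fun U _ => hpt U M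
  simp_rw [hval]
  have ha2 : ∀ M, 0 ≤ a M ^ 2 ∧ a M ^ 2 ≤ 1 := fun M =>
    ⟨sq_nonneg _, by nlinarith [abs_nonneg (a M), sq_abs (a M), ha M]⟩
  calc ∑ M : PMatch n, max ((t : ℝ) ^ 2 * (a M ^ 2 * ∑ U : OddSet n, levelWeight n t C (fun c => w c * (1 - (c : ℝ) / t) ^ 2) U M * f U)) 0
      = (t : ℝ) ^ 2 * ∑ M : PMatch n, max (a M ^ 2 * ∑ U : OddSet n, levelWeight n t C (fun c => w c * (1 - (c : ℝ) / t) ^ 2) U M * f U) 0 := by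
        rw [mul_sum]
        refine sum_congr rfl fun M _ => ?_
        rw [mul_max_of_nonneg _ _ (sq_nonneg (t : ℝ)), mul_zero]
    _ ≤ (t : ℝ) ^ 2 * γ' := mul_le_mul_of_nonneg_left
        (sum_posPart_mul_le_of_rectangles _ hR f hf (fun M => a M ^ 2) ha2) (sq_nonneg _)

/-- **The level direction of (CG_1') for balanced Chebyshev designs — UNCONDITIONAL.** For some `a > 0` and all large even `n`: every balanced
exact design `(t, C, w)` of degree `dq n` on levels `≤ Tq n` with `Σ|w_c| ≤ 20`, every mask `f : cuts → [0,1]` and all scalars `|a_M| ≤ 1`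
satisfy `Σ_M (Σ_U W(U,M) f(U)·(Σ_p a_M x_p x_{π_M p})²)₊ ≤ 20·t²·exp(−a·dq n)` (the `r = 1` rung of the degree-`(dq n − 2)` design
`w_c(1 − c/t)²`). [cite: Rothvoss2017, §2 and Lemma 7 (PDF pp. 6–8)] [cite: KeevashLifshitz2023, Thm. 1.8] [cite: CoppersmithRivlin1992, Thm. (p. 970)] -/
theorem containment_ones_decay :
    ∃ a : ℝ, 0 < a ∧ ∃ n₁ : ℕ, ∀ n : ℕ, n₁ ≤ n → Even n → ∀ (t : ℕ) (C : Finset ℕ) (w : ℕ → ℝ),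
      IsBalancedDesign n t (Tq n) (dq n) 20 C w → ∀ f : OddSet n → ℝ, (∀ U, 0 ≤ f U ∧ f U ≤ 1) →
        ∀ a' : PMatch n → ℝ, (∀ M, |a' M| ≤ 1) →
          ∑ M : PMatch n, max (∑ U : OddSet n, levelWeight n t C w U M *
            (f U * (∑ p, a' M * ((if p ∈ U.1 then (1 : ℝ) else 0) * (if M.2.partner p ∈ U.1 then (1 : ℝ) else 0))) ^ 2)) 0 ≤
          (t : ℝ) ^ 2 * (20 * Real.exp (-(a * (dq n : ℝ)))) := by
  obtain ⟨a, ha, n₁, h⟩ := rectangleDecayAll_holds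
  refine ⟨a, ha, max n₁ (3 ^ 4), fun n hn hev t C w hdes f hf a' ha' => ?_⟩
  have hn₁ : n₁ ≤ n := le_trans (le_max_left _ _) hn
  have h81 : 3 ^ 4 ≤ n := le_trans (le_max_right _ _) hn
  have hD3 : 3 ≤ dq n := by
    unfold dq; rw [Nat.le_sqrt, Nat.le_sqrt]; exact le_trans (by norm_num) h81
  obtain ⟨hex, hbal⟩ := hdes
  have hmod := isExactDesign_levelSq hex hD3
  obtain ⟨c', hc'⟩ := hex.1
  have ht : 0 < t := hex.1.pos
  refine sum_posPart_containment_ones_le ht C w (fun A B => ?_) f hf a' ha'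
  rw [hc'] at hmod hbal ⊢
  exact h n hn₁ hev c' (Tq n) (dq n - 2) 20 C _ hmod hbal le_rfl (by omega) (by omega) A B

/-! ### §3 Low-degree SOS / Boolean masks: (CG_1') is exact per matching -/

/-- **The containment form has Johnson degree `2`**: `U ↦ Σ_p v_p x_p x_{π_M p}` lies in the span of the indicators `1[A ⊆ U]`, `|A| ≤ 2`.
[cite: LeeRaghavendraSteurer2015, §5] -/
theorem containment_mem_lowSpan (M : PMatch n) (v : Fin n → ℝ) :
    (fun U : OddSet n => ∑ p, v p * ((if p ∈ U.1 then (1 : ℝ) else 0) * (if M.2.partner p ∈ U.1 then (1 : ℝ) else 0))) ∈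
      Submodule.span ℝ (Set.range fun A' : {A' : Finset (Fin n) // A'.card ≤ 2} =>
        fun U : OddSet n => if A'.1 ⊆ U.1 then (1 : ℝ) else 0) := by
  classical
  have e : (fun U : OddSet n => ∑ p, v p * ((if p ∈ U.1 then (1 : ℝ) else 0) * (if M.2.partner p ∈ U.1 then (1 : ℝ) else 0))) =
      ∑ p : Fin n, v p • (fun U : OddSet n => if ({p, M.2.partner p} : Finset (Fin n)) ⊆ U.1 then (1 : ℝ) else 0) := by
    funext U
    simp only [Finset.sum_apply, Pi.smul_apply, smul_eq_mul]
    refine sum_congr rfl fun p _ => ?_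
    congr 1
    by_cases hp : p ∈ U.1 <;> by_cases hq : M.2.partner p ∈ U.1 <;> simp [hp, hq, Finset.insert_subset_iff]
  rw [e]
  refine Submodule.sum_mem _ fun p _ => Submodule.smul_mem _ _ (Submodule.subset_span ?_)
  exact ⟨⟨{p, M.2.partner p}, Finset.card_le_two⟩, rfl⟩

/-- **LOW-DEGREE SOS MASKS ARE EXACT FOR (CG_1'), PER MATCHING.** For an exact design `(n, t, T, D, B_v, C, w)`, scalars `g_1,…,g_L` of
Johnson degree `≤ j` with `j + 2 ≤ D` and `2(j + 2) ≤ t + 1`, EVERY perfect matching `M` and EVERY `v : Fin n → ℝ`: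
`Σ_U W(U,M)·(Σ_l g_l(U)²)·(Σ_p v_p x_p x_{π_M p})² ≤ 0`. [cite: Grigoriev2001, Lemma 1.4 (PDF p. 8)] [cite: Rothvoss2017, §2 (PDF p. 6)] -/
theorem containment_sosMask_nonpos {t T D : ℕ} {Bv : ℝ} {C : Finset ℕ} {w : ℕ → ℝ} (hdes : IsExactDesign n t T D Bv C w)
    {j L : ℕ} (hjD : j + 2 ≤ D) (hjt : 2 * (j + 2) ≤ t + 1) (g : Fin L → OddSet n → ℝ)
    (hg : ∀ l, g l ∈ Submodule.span ℝ (Set.range fun A' : {A' : Finset (Fin n) // A'.card ≤ j} =>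
      fun U : OddSet n => if A'.1 ⊆ U.1 then (1 : ℝ) else 0))
    (M : PMatch n) (v : Fin n → ℝ) :
    ∑ U : OddSet n, levelWeight n t C w U M * ((∑ l, g l U ^ 2) *
      (∑ p, v p * ((if p ∈ U.1 then (1 : ℝ) else 0) * (if M.2.partner p ∈ U.1 then (1 : ℝ) else 0))) ^ 2) ≤ 0 := by
  classical
  set Cv : OddSet n → ℝ := fun U => ∑ p, v p * ((if p ∈ U.1 then (1 : ℝ) else 0) * (if M.2.partner p ∈ U.1 then (1 : ℝ) else 0))
    with hCv
  have hC : Cv ∈ Submodule.span ℝ (Set.range fun A' : {A' : Finset (Fin n) // A'.card ≤ 2} =>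
      fun U : OddSet n => if A'.1 ⊆ U.1 then (1 : ℝ) else 0) := containment_mem_lowSpan M v
  -- the `1 × L` factor `[g_1 C_v | … | g_L C_v]` and the matching side `δ_M`
  set A : OddSet n → Matrix (Fin 1) (Fin L) ℝ := fun U => Matrix.of fun _ l => g l U * Cv U with hA
  have hAlow : IsLowDegreeU n (j + 2) A := fun i l => by
    change (fun U => g l U * Cv U) ∈ _
    exact mul_mem_lowSpan (hg l) hC
  set Y : PMatch n → Matrix (Fin 1) (Fin 1) ℝ := fun M' => if M' = M then 1 else 0 with hY
  have hYpsd : ∀ M', (Y M').PosSemidef := fun M' => by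
    rw [hY]; dsimp only
    split_ifs
    · exact Matrix.PosSemidef.one
    · exact Matrix.PosSemidef.zero
  have h := sum_levelWeight_trace_nonpos_of_lowDegree_sharp Grigoriev2001_knapsackFormNonneg_holds hdes hjD hjt A hAlow Y hYpsd
  -- evaluate the trace
  have htr : ∀ U : OddSet n, (A U * (A U)ᵀ).trace = (∑ l, g l U ^ 2) * Cv U ^ 2 := fun U => by
    rw [Matrix.trace_fin_one, Matrix.mul_apply, sum_mul]
    refine sum_congr rfl fun l _ => ?_
    rw [hA]; simp only [Matrix.of_apply, Matrix.transpose_apply]; ring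
  have hM : ∀ U : OddSet n, ∑ M' : PMatch n, levelWeight n t C w U M' * (A U * (A U)ᵀ * Y M').trace =
      levelWeight n t C w U M * ((∑ l, g l U ^ 2) * Cv U ^ 2) := fun U => by
    rw [← htr U]
    have : ∀ M' : PMatch n, levelWeight n t C w U M' * (A U * (A U)ᵀ * Y M').trace =
        if M' = M then levelWeight n t C w U M * (A U * (A U)ᵀ).trace else 0 := fun M' => by
      rw [hY]; dsimp only
      split_ifs with hM'
      · rw [hM', Matrix.mul_one]
      · rw [Matrix.mul_zero, Matrix.trace_zero, mul_zero]
    rw [sum_congr rfl fun M' _ => this M', Finset.sum_ite_eq' univ M, if_pos (mem_univ _)]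
  calc ∑ U : OddSet n, levelWeight n t C w U M * ((∑ l, g l U ^ 2) * Cv U ^ 2)
      = ∑ U : OddSet n, ∑ M' : PMatch n, levelWeight n t C w U M' * (A U * (A U)ᵀ * Y M').trace :=
        sum_congr rfl fun U _ => (hM U).symm
    _ ≤ 0 := h

/-- **{0,1}-VALUED LOW-DEGREE MASKS ARE EXACT FOR (CG_1'), PER MATCHING** (`f = f²`; e.g. junta masks `1[J ⊆ U]`, `|J| = j`): for
`j + 2 ≤ D`, `2(j+2) ≤ t + 1`, every `M`, every `v`: `Σ_U W(U,M)·f(U)·(Σ_p v_p x_p x_{π_M p})² ≤ 0`.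
[cite: Grigoriev2001, Lemma 1.4 (PDF p. 8)] [cite: Rothvoss2017, §2 (PDF p. 6)] -/
theorem containment_boolMask_nonpos {t T D : ℕ} {Bv : ℝ} {C : Finset ℕ} {w : ℕ → ℝ} (hdes : IsExactDesign n t T D Bv C w)
    {j : ℕ} (hjD : j + 2 ≤ D) (hjt : 2 * (j + 2) ≤ t + 1) (f : OddSet n → ℝ) (hf01 : ∀ U, f U = 0 ∨ f U = 1)
    (hf : f ∈ Submodule.span ℝ (Set.range fun A' : {A' : Finset (Fin n) // A'.card ≤ j} =>
      fun U : OddSet n => if A'.1 ⊆ U.1 then (1 : ℝ) else 0))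
    (M : PMatch n) (v : Fin n → ℝ) :
    ∑ U : OddSet n, levelWeight n t C w U M * (f U *
      (∑ p, v p * ((if p ∈ U.1 then (1 : ℝ) else 0) * (if M.2.partner p ∈ U.1 then (1 : ℝ) else 0))) ^ 2) ≤ 0 := by
  have hsq : ∀ U, f U = ∑ _l : Fin 1, f U ^ 2 := fun U => by
    rw [Fin.sum_univ_one]
    rcases hf01 U with h | h <;> rw [h] <;> norm_num
  have h := containment_sosMask_nonpos hdes hjD hjt (fun _ : Fin 1 => f) (fun _ => hf) M v
  simp_rw [← hsq] at h
  exact h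

/-- **The face `f ≡ 1`** (`2 ≤ D`, `3 ≤ t`): `Σ_U W(U,M)·(Σ_p v_p x_p x_{π_M p})² ≤ 0` for every `M`, `v` (closed form: brick 98).
[cite: Grigoriev2001, Lemma 1.4 (PDF p. 8)] -/
theorem containment_one_nonpos {t T D : ℕ} {Bv : ℝ} {C : Finset ℕ} {w : ℕ → ℝ} (hdes : IsExactDesign n t T D Bv C w)
    (hD : 2 ≤ D) (ht : 3 ≤ t) (M : PMatch n) (v : Fin n → ℝ) :
    ∑ U : OddSet n, levelWeight n t C w U M *
      (∑ p, v p * ((if p ∈ U.1 then (1 : ℝ) else 0) * (if M.2.partner p ∈ U.1 then (1 : ℝ) else 0))) ^ 2 ≤ 0 := by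
  have h1 : (fun _ : OddSet n => (1 : ℝ)) ∈ Submodule.span ℝ (Set.range fun A' : {A' : Finset (Fin n) // A'.card ≤ 0} =>
      fun U : OddSet n => if A'.1 ⊆ U.1 then (1 : ℝ) else 0) :=
    Submodule.subset_span ⟨⟨∅, by simp⟩, by funext U; simp⟩
  have h := containment_boolMask_nonpos hdes (j := 0) (by omega) (by omega) (fun _ => 1) (fun _ => Or.inr rfl) h1 M v
  simpa only [one_mul] using h

end Summit.PneNP.PneNP.Theorems.ChebyshevTracialDesignPairContainmentCells
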